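import Summits.ValiantsHypothesis.ValiantsHypothesis.Theorems.BarrierLeverAnchoredDoorHitsLowerPairsDecrementGeneralSupport

/-!
# Support item `AnchoredDoorHitsLowerPairs` (stmt-ValiantsHypothesis-22510), line `anchored-peeling`:
# THE DECREMENT CERTIFICATE FOR GENERAL `k` — TRIANGULARITY AT CROSSES AND E-COLUMNS, ASSEMBLY: CONJECTURE DC IS A THEOREM (`theorem stub_decrementFamily`)

Helper file (`--supports stmt-ValiantsHypothesis-22510`; cell valiant-natproofs, rung V4, 𝒟-side door (c); registered line
`Cruxes/AnchoredDoorHitsLowerPairs/Lines/anchored_peeling.lean` v20, registered stub `Stmt.stub_decrementFamily` (CONJECTURE DC, `…DecrementFamily`,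
p650456); prover seat val-np-p1 gen 23; memo HOME/val-np-p1/g22/MEMO-relapex-valnp1-g22.md §12–§15 = the paper proof being formalised; definitions in
`…DecrementGeneralDefs` (p652973)). Closes NO item by itself; part of the kernel proof of `theorem stub_decrementFamily` (`…DecrementGeneral`).

WHAT. (§9–§10 of the development.) `supp_cross`, `supp_gg`, `supp_dd` (the E-column case analysis of memo §15: personas against `α`-blocks, the binary order
`S < T` / `T ≤ S` choosing the owner `γ_Sγ_T` / `δ_Tδ_{S+1}`, ties broken by the popcount parity in the third key component), `supp_key` (all nine types);
`symbolicDet_one_ne_zero_decFamily`: the decrement certificate in KEY FORM (`symbolicDet_one_ne_zero_of_key`, `…LTKey` p650999) — designated rows give an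
injective map columns → rows (hence a permutation of `Fin r`), the key is injective, the diagonal is supported, and supports only see designated rows of columns
with smaller-or-equal key — so **the canonical residual pair `(R_{k+1}, K_{2^{k+1}−1})` is hit at profile 1 for EVERY `k ≥ 1`**, in every characteristic
(0/1 doors). Finally `theorem stub_decrementFamily : Stmt.stub_decrementFamily` — the REGISTERED stub of the line, by name and verbatim signature.
Kernel instances `k ≤ 3` were landed before by `decide` (`…DecrementCertificate`, `…LTInstanceR4K15`); this file supersedes them uniformly.

WHAT THIS IS NOT: nothing on crux stmt-ValiantsHypothesis-14610 or on `VP` versus `VNP`.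
-/

set_option linter.dupNamespace false

namespace Summit.ValiantsHypothesis.ValiantsHypothesis.Theorems.BarrierLever.AnchoredPeeling

namespace DecFamily

open Finset

variable {h : ℕ}

/-! ## 9 (continued). Triangularity at crosses and E-columns; all nine types -/

section Support

variable {k : ℕ}

/-- Triangularity at a cross `γ_Pδ_Q`. -/
theorem supp_cross {P Q : ℕ} (hd : (Col.cross P Q).Valid k) (hkh : 2 * k + 1 ≤ h) (hKh : 2 ^ (k + 1) - 1 ≤ h) {U : Finset (Fin h)}
    (hsupp : DoorSupp (roots k) (tails k) (colOf k (.cross P Q)) U) :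
    U = dRow k (.cross P Q) ∨ (own (aIdx k U) (eBit k U) (bIdx k U)).key k < (Col.cross P Q).key k := by
  obtain ⟨hR1, hR2, hR3⟩ := radix_facts k
  have hpow := two_pow_succ_eq k
  obtain ⟨h1, h2, h3, h4⟩ := hd
  rw [colOf_eq_pair (c := P) (c' := 2 ^ k + Q) h1 (by omega) (by omega) (by omega) rfl,
    doorSupp_pair_iff _ _ (fun heq => by have := Fin.ext_iff.mp heq; simp only [] at this; omega)] at hsupp
  obtain ⟨X, Y, hX, hY, hXY, rfl⟩ := hsupp
  obtain ⟨-, hXs⟩ := isBlock_gam (c := P) (by simp only []; omega) h2 hX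
  obtain ⟨-, hYs⟩ := isBlock_del (Q := Q) (by simp only []; omega) h3 h4 hY
  rcases hXs with ⟨hXe, hXb, hXa, hXρ⟩ | ⟨hXe, hXa, hXb⟩ <;> rcases hYs with ⟨hYe, hYa, hYb, hYρ⟩ | ⟨hYe, hYb, hYa⟩
  · -- persona / persona : (S, 0, T)
    have hA : aIdx k (X ∪ Y) = aIdx k X := by rw [aIdx_union, hYa, Finset.union_empty]
    have hE : eBit k (X ∪ Y) = false := by rw [eBit_union, hXe, hYe]; rfl
    have hB : bIdx k (X ∪ Y) = bIdx k Y := by rw [bIdx_union, hXb, Finset.empty_union]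
    rw [hA, hE, hB]
    by_cases hUd : aIdx k X = bits P ∧ bIdx k Y = bits Q
    · exact Or.inl (eq_dRow_of (hA.trans hUd.1) hE (hB.trans hUd.2))
    · right
      have hSP : enc (aIdx k X) ≤ P := enc_le_of_subset_bits hXa
      have hTQ : enc (bIdx k Y) ≤ Q := enc_le_of_subset_bits hYb
      have hkey : enc (aIdx k X) < P ∨ (enc (aIdx k X) = P ∧ enc (bIdx k Y) < Q) := by
        rcases Nat.lt_or_ge (enc (aIdx k X)) P with hl | hge
        · exact Or.inl hl
        · refine Or.inr ⟨by omega, enc_lt_of_ne_bits hYb fun hh => hUd ⟨eq_bits_of_enc_eq (by omega), hh⟩⟩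
      rw [own_cross (Finset.ne_empty_of_mem hXρ) (Finset.ne_empty_of_mem hYρ)]
      refine key_lt_key ?_ ?_ ?_ ?_ ?_ <;> simp only [Col.tup, true_and, and_false, false_or, or_false, lt_self_iff_false] <;> omega
  · -- persona / alpha : (S ∪ Y, 1, ∅)
    right
    have hA : aIdx k (X ∪ Y) = aIdx k X ∪ aIdx k Y := aIdx_union X Y
    have hE : eBit k (X ∪ Y) = true := by rw [eBit_union, hYe, Bool.or_true]
    have hB : bIdx k (X ∪ Y) = ∅ := by rw [bIdx_union, hXb, hYb]; rfl
    have hSk : enc (aIdx k X ∪ aIdx k Y) < 2 ^ k := enc_lt_two_pow (Finset.union_subset (aIdx_subset_range k X) (aIdx_subset_range k Y))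
    rw [hA, hE, hB, own_omGam (Finset.ne_empty_of_mem (Finset.mem_union_left _ hXρ))]
    refine key_lt_key ?_ ?_ ?_ ?_ ?_ <;> simp only [Col.tup, and_false, or_false, lt_self_iff_false] <;> omega
  · -- alpha / persona : (∅, 1, Y ∪ T)
    right
    have hA : aIdx k (X ∪ Y) = ∅ := by rw [aIdx_union, hXa, hYa]; rfl
    have hE : eBit k (X ∪ Y) = true := by rw [eBit_union, hXe, Bool.true_or]
    have hB : bIdx k (X ∪ Y) = bIdx k X ∪ bIdx k Y := bIdx_union X Y
    have hTk : enc (bIdx k X ∪ bIdx k Y) < 2 ^ k :=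
      enc_lt_two_pow (Finset.union_subset (hXb.trans (bits_subset_range h2)) (hYb.trans (bits_subset_range h4)))
    rw [hA, hE, hB, own_omDel (Finset.ne_empty_of_mem (Finset.mem_union_right _ hYρ))]
    refine key_lt_key ?_ ?_ ?_ ?_ ?_ <;> simp only [Col.tup, and_false, or_false, lt_self_iff_false] <;> omega
  · exact absurd ⟨hXe, hYe⟩ (not_eBit_and hXY)

/-- Triangularity at an E-column `γ_Pγ_P'` (`P < P'`). -/
theorem supp_gg {P P' : ℕ} (hd : (Col.gg P P').Valid k) (hKh : 2 ^ (k + 1) - 1 ≤ h) {U : Finset (Fin h)}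
    (hsupp : DoorSupp (roots k) (tails k) (colOf k (.gg P P')) U) :
    U = dRow k (.gg P P') ∨ (own (aIdx k U) (eBit k U) (bIdx k U)).key k < (Col.gg P P').key k := by
  obtain ⟨hR1, hR2, hR3⟩ := radix_facts k
  have hpow := two_pow_succ_eq k
  obtain ⟨h1, h2, h3⟩ := hd
  have hP'k : (bits P').card ≤ k := card_bits_le h3
  rw [colOf_eq_pair (c := P) (c' := P') h1 (by omega) (by omega) (by omega) rfl,
    doorSupp_pair_iff _ _ (fun heq => by have := Fin.ext_iff.mp heq; simp only [] at this; omega)] at hsupp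
  obtain ⟨X, Y, hX, hY, hXY, rfl⟩ := hsupp
  obtain ⟨-, hXs⟩ := isBlock_gam (c := P) (by simp only []; omega) (by omega) hX
  obtain ⟨-, hYs⟩ := isBlock_gam (c := P') (by simp only []; omega) h3 hY
  rcases hXs with ⟨hXe, hXb, hXa, hXρ⟩ | ⟨hXe, hXa, hXb⟩ <;> rcases hYs with ⟨hYe, hYb, hYa, hYρ⟩ | ⟨hYe, hYa, hYb⟩
  · -- persona / persona : (S ∪ S', 0, ∅) — a vertex column, class 3
    right
    have hA : aIdx k (X ∪ Y) = aIdx k X ∪ aIdx k Y := aIdx_union X Y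
    have hE : eBit k (X ∪ Y) = false := by rw [eBit_union, hXe, hYe]; rfl
    have hB : bIdx k (X ∪ Y) = ∅ := by rw [bIdx_union, hXb, hYb]; rfl
    have hSk : enc (aIdx k X ∪ aIdx k Y) < 2 ^ k := enc_lt_two_pow (Finset.union_subset (aIdx_subset_range k X) (aIdx_subset_range k Y))
    rw [hA, hE, hB, own_gam (Finset.ne_empty_of_mem (Finset.mem_union_left _ hXρ))]
    refine key_lt_key ?_ ?_ ?_ ?_ ?_ <;> simp only [Col.tup] <;> omega
  · -- persona X = a_S / alpha Y = α ∪ b_Y' : the row (S, 1, Y')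
    have hA : aIdx k (X ∪ Y) = aIdx k X := by rw [aIdx_union, hYa, Finset.union_empty]
    have hE : eBit k (X ∪ Y) = true := by rw [eBit_union, hYe, Bool.or_true]
    have hB : bIdx k (X ∪ Y) = bIdx k Y := by rw [bIdx_union, hXb, Finset.empty_union]
    rw [hA, hE, hB]
    have hSne : aIdx k X ≠ ∅ := Finset.ne_empty_of_mem hXρ
    have hSP : enc (aIdx k X) ≤ P := enc_le_of_subset_bits hXa
    have hYP' : enc (bIdx k Y) ≤ P' := enc_le_of_subset_bits hYb
    have hcS : (aIdx k X).card ≤ k := card_le_of_subset_range (aIdx_subset_range k X)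
    have hcY : (bIdx k Y).card ≤ (bits P').card := Finset.card_le_card hYb
    by_cases hT0 : bIdx k Y = ∅
    · right; rw [hT0, own_omGam hSne]
      refine key_lt_key ?_ ?_ ?_ ?_ ?_ <;> simp only [Col.tup] <;> omega
    by_cases hUd : aIdx k X = bits P ∧ bIdx k Y = bits P'
    · exact Or.inl (eq_dRow_of (hA.trans hUd.1) hE (hB.trans hUd.2))
    right
    rcases Nat.lt_or_ge (enc (aIdx k X)) (enc (bIdx k Y)) with hlt | hle
    · -- owner γ_S γ_{Y'} : (5, S, 2|Y'|+1, Y') < (5, P, 2|P'|+1, P')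
      have hkey : enc (aIdx k X) < P ∨ (enc (aIdx k X) = P ∧ (bIdx k Y).card < (bits P').card) := by
        rcases Nat.lt_or_ge (enc (aIdx k X)) P with hl | hge
        · exact Or.inl hl
        · exact Or.inr ⟨by omega, card_lt_of_ne_bits hYb fun hh => hUd ⟨eq_bits_of_enc_eq (by omega), hh⟩⟩
      rw [own_gg hSne hT0 hlt]
      refine key_lt_key ?_ ?_ ?_ ?_ ?_ <;> simp only [Col.tup, bits_enc, true_and, false_or, lt_self_iff_false] <;> omega
    · -- owner δ_{Y'} δ_{S+1} : (5, Y', 2|S|, S+1) < (5, P, 2|P'|+1, P')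
      have hkey : enc (bIdx k Y) < P ∨ (enc (bIdx k Y) = P ∧ (aIdx k X).card ≤ (bits P').card) := by
        rcases Nat.lt_or_ge (enc (bIdx k Y)) P with hl | hge
        · exact Or.inl hl
        · have hSY : aIdx k X = bIdx k Y := enc_injective (by omega)
          exact Or.inr ⟨by omega, by rw [hSY]; exact hcY⟩
      rw [own_dd hSne hT0 hle]
      refine key_lt_key ?_ ?_ ?_ ?_ ?_ <;> simp only [Col.tup, Nat.add_sub_cancel, bits_enc, true_and, false_or, lt_self_iff_false] <;> omega
  · -- alpha X = α ∪ b_Y / persona Y = a_{S'} : the row (S', 1, Y)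
    right
    have hA : aIdx k (X ∪ Y) = aIdx k Y := by rw [aIdx_union, hXa, Finset.empty_union]
    have hE : eBit k (X ∪ Y) = true := by rw [eBit_union, hXe, Bool.true_or]
    have hB : bIdx k (X ∪ Y) = bIdx k X := by rw [bIdx_union, hYb, Finset.union_empty]
    rw [hA, hE, hB]
    have hSne : aIdx k Y ≠ ∅ := Finset.ne_empty_of_mem hYρ
    have hS'P' : enc (aIdx k Y) ≤ P' := enc_le_of_subset_bits hYa
    have hYP : enc (bIdx k X) ≤ P := enc_le_of_subset_bits hXb
    have hcS' : (aIdx k Y).card ≤ (bits P').card := Finset.card_le_card hYa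
    have hcY : (bIdx k X).card ≤ k := card_le_of_subset_range (hXb.trans (bits_subset_range (by omega)))
    by_cases hT0 : bIdx k X = ∅
    · rw [hT0, own_omGam hSne]
      refine key_lt_key ?_ ?_ ?_ ?_ ?_ <;> simp only [Col.tup] <;> omega
    rcases Nat.lt_or_ge (enc (aIdx k Y)) (enc (bIdx k X)) with hlt | hle
    · -- owner γ_{S'} γ_Y : first coordinate S' < Y ≤ P
      rw [own_gg hSne hT0 hlt]
      refine key_lt_key ?_ ?_ ?_ ?_ ?_ <;> simp only [Col.tup, bits_enc, true_and, false_or, lt_self_iff_false] <;> omega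
    · -- owner δ_Y δ_{S'+1} : (5, Y, 2|S'|, S'+1); Y ≤ P, and if Y = P then 2|S'| ≤ 2|P'| < 2|P'|+1
      rw [own_dd hSne hT0 hle]
      refine key_lt_key ?_ ?_ ?_ ?_ ?_ <;> simp only [Col.tup, Nat.add_sub_cancel, bits_enc, true_and, false_or, lt_self_iff_false] <;> omega
  · exact absurd ⟨hXe, hYe⟩ (not_eBit_and hXY)

/-- Triangularity at an E-column `δ_Qδ_Q'` (`Q < Q'`). -/
theorem supp_dd {Q Q' : ℕ} (hd : (Col.dd Q Q').Valid k) (hKh : 2 ^ (k + 1) - 1 ≤ h) {U : Finset (Fin h)}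
    (hsupp : DoorSupp (roots k) (tails k) (colOf k (.dd Q Q')) U) :
    U = dRow k (.dd Q Q') ∨ (own (aIdx k U) (eBit k U) (bIdx k U)).key k < (Col.dd Q Q').key k := by
  obtain ⟨hR1, hR2, hR3⟩ := radix_facts k
  have hpow := two_pow_succ_eq k
  obtain ⟨h1, h2, h3⟩ := hd
  have hQ'k : (bits (Q' - 1)).card ≤ k := card_bits_le (by omega)
  rw [colOf_eq_pair (c := 2 ^ k + Q) (c' := 2 ^ k + Q') (by omega) (by omega) (by omega) (by omega) rfl,
    doorSupp_pair_iff _ _ (fun heq => by have := Fin.ext_iff.mp heq; simp only [] at this; omega)] at hsupp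
  obtain ⟨X, Y, hX, hY, hXY, rfl⟩ := hsupp
  obtain ⟨-, hXs⟩ := isBlock_del (Q := Q) (by simp only []; omega) h1 (by omega) hX
  obtain ⟨-, hYs⟩ := isBlock_del (Q := Q') (by simp only []; omega) (by omega) h3 hY
  rcases hXs with ⟨hXe, hXa, hXb, hXρ⟩ | ⟨hXe, hXb, hXa⟩ <;> rcases hYs with ⟨hYe, hYa, hYb, hYρ⟩ | ⟨hYe, hYb, hYa⟩
  · -- persona / persona : (∅, 0, T ∪ T') — a vertex column, class 3
    right
    have hA : aIdx k (X ∪ Y) = ∅ := by rw [aIdx_union, hXa, hYa]; rfl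
    have hE : eBit k (X ∪ Y) = false := by rw [eBit_union, hXe, hYe]; rfl
    have hB : bIdx k (X ∪ Y) = bIdx k X ∪ bIdx k Y := bIdx_union X Y
    have hTk : enc (bIdx k X ∪ bIdx k Y) < 2 ^ k :=
      enc_lt_two_pow (Finset.union_subset (hXb.trans (bits_subset_range (by omega))) (hYb.trans (bits_subset_range h3)))
    rw [hA, hE, hB, own_del (Finset.ne_empty_of_mem (Finset.mem_union_left _ hXρ))]
    refine key_lt_key ?_ ?_ ?_ ?_ ?_ <;> simp only [Col.tup] <;> omega
  · -- persona X = b_T / alpha Y = α ∪ a_{Y'}, Y' ⊆ Q'−1 : the row (Y', 1, T)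
    have hA : aIdx k (X ∪ Y) = aIdx k Y := by rw [aIdx_union, hXa, Finset.empty_union]
    have hE : eBit k (X ∪ Y) = true := by rw [eBit_union, hYe, Bool.or_true]
    have hB : bIdx k (X ∪ Y) = bIdx k X := by rw [bIdx_union, hYb, Finset.union_empty]
    rw [hA, hE, hB]
    have hTne : bIdx k X ≠ ∅ := Finset.ne_empty_of_mem hXρ
    have hTQ : enc (bIdx k X) ≤ Q := enc_le_of_subset_bits hXb
    have hY'Q' : enc (aIdx k Y) ≤ Q' - 1 := enc_le_of_subset_bits hYa
    have hcY' : (aIdx k Y).card ≤ (bits (Q' - 1)).card := Finset.card_le_card hYa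
    have hcT : (bIdx k X).card ≤ k := card_le_of_subset_range (hXb.trans (bits_subset_range (by omega)))
    by_cases hS0 : aIdx k Y = ∅
    · right; rw [hS0, own_omDel hTne]
      refine key_lt_key ?_ ?_ ?_ ?_ ?_ <;> simp only [Col.tup] <;> omega
    by_cases hUd : aIdx k Y = bits (Q' - 1) ∧ bIdx k X = bits Q
    · exact Or.inl (eq_dRow_of (hA.trans hUd.1) hE (hB.trans hUd.2))
    right
    rcases Nat.lt_or_ge (enc (aIdx k Y)) (enc (bIdx k X)) with hlt | hle
    · -- owner γ_{Y'} γ_T : first coordinate Y' < T ≤ Q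
      rw [own_gg hS0 hTne hlt]
      refine key_lt_key ?_ ?_ ?_ ?_ ?_ <;> simp only [Col.tup, bits_enc, true_and, false_or, lt_self_iff_false] <;> omega
    · -- owner δ_T δ_{Y'+1} : (5, T, 2|Y'|, Y'+1) < (5, Q, 2|Q'−1|, Q')
      have hkey : enc (bIdx k X) < Q ∨ (enc (bIdx k X) = Q ∧ (aIdx k Y).card < (bits (Q' - 1)).card) := by
        rcases Nat.lt_or_ge (enc (bIdx k X)) Q with hl | hge
        · exact Or.inl hl
        · exact Or.inr ⟨by omega, card_lt_of_ne_bits hYa fun hh => hUd ⟨hh, eq_bits_of_enc_eq (by omega)⟩⟩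
      rw [own_dd hS0 hTne hle]
      refine key_lt_key ?_ ?_ ?_ ?_ ?_ <;> simp only [Col.tup, Nat.add_sub_cancel, bits_enc, true_and, false_or, lt_self_iff_false] <;> omega
  · -- alpha X = α ∪ a_Y, Y ⊆ Q−1 / persona Y = b_{T'} : the row (Y, 1, T')
    right
    have hA : aIdx k (X ∪ Y) = aIdx k X := by rw [aIdx_union, hYa, Finset.union_empty]
    have hE : eBit k (X ∪ Y) = true := by rw [eBit_union, hXe, Bool.true_or]
    have hB : bIdx k (X ∪ Y) = bIdx k Y := by rw [bIdx_union, hXb, Finset.empty_union]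
    rw [hA, hE, hB]
    have hTne : bIdx k Y ≠ ∅ := Finset.ne_empty_of_mem hYρ
    have hYQ : enc (aIdx k X) ≤ Q - 1 := enc_le_of_subset_bits hXa
    have hT'Q' : enc (bIdx k Y) ≤ Q' := enc_le_of_subset_bits hYb
    have hcY : (aIdx k X).card ≤ k := card_le_of_subset_range (aIdx_subset_range k X)
    have hcT' : (bIdx k Y).card ≤ k := card_le_of_subset_range (hYb.trans (bits_subset_range h3))
    by_cases hS0 : aIdx k X = ∅
    · rw [hS0, own_omDel hTne]
      refine key_lt_key ?_ ?_ ?_ ?_ ?_ <;> simp only [Col.tup] <;> omega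
    rcases Nat.lt_or_ge (enc (aIdx k X)) (enc (bIdx k Y)) with hlt | hle
    · -- owner γ_Y γ_{T'} : first coordinate Y ≤ Q − 1 < Q
      rw [own_gg hS0 hTne hlt]
      refine key_lt_key ?_ ?_ ?_ ?_ ?_ <;> simp only [Col.tup, bits_enc, true_and, false_or, lt_self_iff_false] <;> omega
    · -- owner δ_{T'} δ_{Y+1} : first coordinate T' ≤ Y ≤ Q − 1 < Q
      rw [own_dd hS0 hTne hle]
      refine key_lt_key ?_ ?_ ?_ ?_ ?_ <;> simp only [Col.tup, Nat.add_sub_cancel, bits_enc, true_and, false_or, lt_self_iff_false] <;> omega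
  · exact absurd ⟨hXe, hYe⟩ (not_eBit_and hXY)

/-- **TRIANGULARITY (all nine column types).** A row in the support of a valid column is its designated row, or its owner has a strictly smaller key. -/
theorem supp_key {d : Col} (hd : d.Valid k) (hkh : 2 * k + 1 ≤ h) (hKh : 2 ^ (k + 1) - 1 ≤ h) {U : Finset (Fin h)}
    (hsupp : DoorSupp (roots k) (tails k) (colOf k d) U) :
    U = dRow k d ∨ (own (aIdx k U) (eBit k U) (bIdx k U)).key k < d.key k := by
  cases d with
  | empty => exact supp_empty hsupp
  | om => exact supp_om hKh hsupp
  | gam P => exact supp_gam hd hKh hsupp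
  | del Q => exact supp_del hd hKh hsupp
  | omGam P => exact supp_omGam hd hkh hKh hsupp
  | omDel Q => exact supp_omDel hd hkh hKh hsupp
  | cross P Q => exact supp_cross hd hkh hKh hsupp
  | gg P P' => exact supp_gg hd hKh hsupp
  | dd Q Q' => exact supp_dd hd hKh hsupp

end Support

/-! ## 10. Assembly: the decrement certificate is an LT certificate in key form for every `k` — CONJECTURE DC -/

section Assembly

variable {k : ℕ}

/-- The owner of a designated row is its column. -/
theorem own_dRow {d : Col} (hd : d.Valid k) (hkh : 2 * k + 1 ≤ h) :
    own (aIdx k (dRow (h := h) k d)) (eBit k (dRow (h := h) k d)) (bIdx k (dRow (h := h) k d)) = d := by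
  simp only [dRow]
  rw [aIdx_rowOf (dtrip_subset_range hd).1 hkh, eBit_rowOf hkh, bIdx_rowOf (dtrip_subset_range hd).2 hkh]
  exact own_dtrip hd

/-- **THE CANONICAL RESIDUAL FAMILY IS HIT AT PROFILE 1, for every `k ≥ 1`** (the decrement certificate in key form fed to `symbolicDet_one_ne_zero_of_key`:
designated rows `dRow`, key `Col.key`; diagonal `doorSupp_dRow`, triangularity `supp_key`, bijectivity from `eq_of_dRow_eq`). Injectivity of the
row enumeration is not needed (it follows). -/
theorem symbolicDet_one_ne_zero_decFamily (k h r : ℕ) (u w : Fin r → Finset (Fin h)) (hk : 1 ≤ k) (hkh : 2 * k + 1 ≤ h)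
    (hKh : 2 ^ (k + 1) - 1 ≤ h) (hw : Function.Injective w)
    (hU : ∀ U : Finset (Fin h), U ∈ Set.range u ↔ DecRow k h U) (hW : ∀ W : Finset (Fin h), W ∈ Set.range w ↔ DecCol k h W) :
    symbolicDet 1 h r u w ≠ 0 := by
  classical
  -- descriptors of the columns
  have hdesc : ∀ j, ∃ d : Col, d.Valid k ∧ colOf k d = w j := fun j => exists_col_of_decCol ((hW (w j)).mp ⟨j, rfl⟩)
  choose desc hvalid hcol using hdesc
  -- designated rows are rows of the family: their indices
  have hrow : ∀ j, ∃ i, u i = dRow k (desc j) := fun j => (hU _).mpr (decRow_dRow (hvalid j) hk hkh)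
  choose dj hdj using hrow
  -- `dj` is injective, hence a permutation of `Fin r`
  have hinj : Function.Injective dj := by
    intro j j' hjj
    have h1 : dRow (h := h) k (desc j) = dRow k (desc j') := by rw [← hdj j, ← hdj j', hjj]
    have h2 : desc j = desc j' := eq_of_dRow_eq (hvalid j) (hvalid j') hkh h1
    apply hw
    rw [← hcol j, ← hcol j', h2]
  let d : Equiv.Perm (Fin r) := Equiv.ofBijective dj (Finite.injective_iff_bijective.mp hinj)
  refine symbolicDet_one_ne_zero_of_key u w (roots k) (tails k) d (fun j => (desc j).key k) ?_ ?_ ?_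
  · -- the key is injective
    intro j j' hjj
    have h2 : desc j = desc j' := eq_of_key_eq (hvalid j) (hvalid j') hjj
    apply hw
    rw [← hcol j, ← hcol j', h2]
  · -- the diagonal
    intro j
    show DoorSupp (roots k) (tails k) (w j) (u (dj j))
    rw [hdj j, ← hcol j]
    exact doorSupp_dRow (hvalid j) hkh hKh
  · -- the key decreases along supports
    intro j j' hsupp
    change DoorSupp (roots k) (tails k) (w j) (u (dj j')) at hsupp
    rw [hdj j', ← hcol j] at hsupp
    rcases supp_key (hvalid j) hkh hKh hsupp with heq | hlt
    · rw [eq_of_dRow_eq (hvalid j') (hvalid j) hkh heq]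
    · rw [own_dRow (hvalid j') hkh] at hlt
      exact hlt.le

end Assembly

end DecFamily

/-- **CONJECTURE DC IS A THEOREM — the registered stub `stub_decrementFamily` of line `anchored_peeling` v20** (statement `Stmt.stub_decrementFamily`,
`…DecrementFamily`, p650456, verbatim): for every `k ≥ 1` and every injective enumeration of the canonical residual pair `(R_{k+1}, K_{2^{k+1}−1})`
the profile-1 symbolic minor is nonzero. Proof: the DECREMENT CERTIFICATE (memo g22 §12–§15) as an LT certificate in key form, `DecFamily.*`. -/
theorem stub_decrementFamily : Stmt.stub_decrementFamily :=
  fun k h r u w hk hkh hKh _ hw hU hW => DecFamily.symbolicDet_one_ne_zero_decFamily k h r u w hk hkh hKh hw hU hW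

end Summit.ValiantsHypothesis.ValiantsHypothesis.Theorems.BarrierLever.AnchoredPeeling
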